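import Summits.KontsevichZagierPeriods.KontsevichZagierPeriods.Theorems.SoloInformedNLShear
import HarnessLib
import HarnessLib.Audit

/-!
# SoloInformed — the band pieces of the left-hand side: cell sheets and their signed multiplicities (Newton–Leibniz elimination, file 4c-ii-c)

Solo programme `solo-KontsevichZagierPeriods-informed`, session s245 (K-NF, `paper/nl-elimination.md`
§7.2, FILE 4c-ii).

The left-hand side `[r] = [∫_B f]` of a Newton–Leibniz datum (`B = band τ a b`, primitive `F`) is
split along a `ℚ`-cylindrical decomposition into the pieces `[cadRep r C]` over the open cells
`C = bandOver S (ξ S) j ⊆ B` (files 592, 597).  On a cell inside the smooth locus of `F` where `f`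
has a sign, the substitution `Ψ_F` turns the piece into `±[𝟙_{Ψ_F(C)}]` (file 593); here:

* `soloInformedCellPosSheet` / `soloInformedCellNegSheet`: the sheets of a cell piece, with
  `[cadRep r C] − [pos] ∈ relations₁₂`, `[cadRep r C] + [neg] ∈ relations₁₂`, domain `Ψ_F '' C`;
* `x ↦ F (x, u x)` is `ℚ`-semialgebraic on `S` for semialgebraic `u` with graph in `B`, so the
  "crossing graphs" `graphOver S (F(·, u ·))` are null semialgebraic sets which open cells of an
  adapted decomposition avoid;
* the signed multiplicity of one band sheet, `ε_j·𝟙[w ∈ Ψ_F(C_j)] = sInd (F(x,lo_j)) (F(x,hi_j)) y`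
  (LEMMA C of the paper, file 590), and its sum over the bands of `B` over `x`:
  `∑_j ε_j·𝟙[w ∈ Ψ_F(C_j)] = sInd (F(x, a x)) (F(x, b x)) y` (fibrewise telescope, file 595).

References: this work (THEOREM NF, `paper/nl-elimination.md` §2, LEMMA C and KEY LEMMA (K)).
-/

noncomputable section

open scoped BigOperators Topology ContDiff

namespace Summit.KontsevichZagierPeriods.KontsevichZagierPeriods.Theorems

open Set MeasureTheory Filter MvPolynomial
open Literature.ModelTheory.ExponentialFields
open Literature.NumberTheory.Transcendental Literature.NumberTheory.Transcendental.KZ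

variable {n : ℕ}

/-! ### Cell sheets of the left-hand side -/

section CellSheet

variable {r : IntegralRep (n + 1)} {F : (Fin (n + 1) → ℝ) → ℝ} {C G : Set (Fin (n + 1) → ℝ)}
  {τ : Set (Fin n → ℝ)} {a b : (Fin n → ℝ) → ℝ}

/-- **Positive cell sheet**: the sheet `[𝟙_{Ψ_F(C)}]` of the piece `[cadRep r C]` of a Newton–Leibniz
left-hand side over an open cell `C ⊆ B ∩ G` (`G` the smooth locus of `F`) with convex fibres on
which `f = r.integrand > 0`. -/
def soloInformedCellPosSheet (r : IntegralRep (n + 1)) (F : (Fin (n + 1) → ℝ) → ℝ)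
    (C : Set (Fin (n + 1) → ℝ)) {G : Set (Fin (n + 1) → ℝ)} {τ : Set (Fin n → ℝ)}
    {a b : (Fin n → ℝ) → ℝ} (hFs : IsSemialgebraicFunOn ℚ r.domain F)
    (hC : IsSemialgebraic ℚ C) (hCr : C ⊆ r.domain) (hCo : IsOpen C) (hG : IsOpen G)
    (hFG : ContDiffOn ℝ ∞ F G) (hCG : C ⊆ G) (hdom : r.domain = KZlog.band τ a b)
    (hNL : ∀ x ∈ τ, ∀ t ∈ Ioo (a x) (b x),
      HasDerivAt (fun s : ℝ => F (Fin.snoc x s)) (r.integrand (Fin.snoc x t)) t)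
    (hconv : ∀ x, Convex ℝ (soloInformedFibre C x)) (hpos : ∀ z ∈ C, 0 < r.integrand z) :
    IntegralRep (n + 1) :=
  soloInformedPosSheet (soloInformedCadRep r C) F (fun z => fderiv ℝ F z)
    (by rw [soloInformed_cadRep_domain r hC hCr]; exact hFs.mono hCr hC)
    (soloInformed_nl_sheetData_cadRep r hC hCr hCo hG hFG hCG hdom hNL).1
    (by rw [soloInformed_cadRep_domain r hC hCr]; exact hconv)
    (soloInformed_nl_sheetData_cadRep r hC hCr hCo hG hFG hCG hdom hNL).2
    (fun z hz => by
      rw [soloInformed_cadRep_integrand]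
      exact hpos z (by rw [soloInformed_cadRep_domain r hC hCr] at hz; exact hz))

/-- The positive cell sheet has domain `Ψ_F '' C`. -/
theorem soloInformed_cellPosSheet_domain (hFs : IsSemialgebraicFunOn ℚ r.domain F)
    (hC : IsSemialgebraic ℚ C) (hCr : C ⊆ r.domain) (hCo : IsOpen C) (hG : IsOpen G)
    (hFG : ContDiffOn ℝ ∞ F G) (hCG : C ⊆ G) (hdom : r.domain = KZlog.band τ a b)
    (hNL : ∀ x ∈ τ, ∀ t ∈ Ioo (a x) (b x),
      HasDerivAt (fun s : ℝ => F (Fin.snoc x s)) (r.integrand (Fin.snoc x t)) t)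
    (hconv : ∀ x, Convex ℝ (soloInformedFibre C x)) (hpos : ∀ z ∈ C, 0 < r.integrand z) :
    (soloInformedCellPosSheet r F C hFs hC hCr hCo hG hFG hCG hdom hNL hconv hpos).domain =
      soloInformedLastSubst F '' C := by
  show soloInformedLastSubst F '' (soloInformedCadRep r C).domain = soloInformedLastSubst F '' C
  rw [soloInformed_cadRep_domain r hC hCr]

/-- The positive cell sheet has integrand `1`. -/
@[simp] theorem soloInformed_cellPosSheet_integrand (hFs : IsSemialgebraicFunOn ℚ r.domain F)
    (hC : IsSemialgebraic ℚ C) (hCr : C ⊆ r.domain) (hCo : IsOpen C) (hG : IsOpen G)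
    (hFG : ContDiffOn ℝ ∞ F G) (hCG : C ⊆ G) (hdom : r.domain = KZlog.band τ a b)
    (hNL : ∀ x ∈ τ, ∀ t ∈ Ioo (a x) (b x),
      HasDerivAt (fun s : ℝ => F (Fin.snoc x s)) (r.integrand (Fin.snoc x t)) t)
    (hconv : ∀ x, Convex ℝ (soloInformedFibre C x)) (hpos : ∀ z ∈ C, 0 < r.integrand z) :
    (soloInformedCellPosSheet r F C hFs hC hCr hCo hG hFG hCG hdom hNL hconv hpos).integrand =
      fun _ => 1 :=
  rfl

/-- **The cell piece minus its positive sheet is a relation.** -/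
theorem soloInformed_of_cadRep_sub_of_cellPosSheet_mem (hFs : IsSemialgebraicFunOn ℚ r.domain F)
    (hC : IsSemialgebraic ℚ C) (hCr : C ⊆ r.domain) (hCo : IsOpen C) (hG : IsOpen G)
    (hFG : ContDiffOn ℝ ∞ F G) (hCG : C ⊆ G) (hdom : r.domain = KZlog.band τ a b)
    (hNL : ∀ x ∈ τ, ∀ t ∈ Ioo (a x) (b x),
      HasDerivAt (fun s : ℝ => F (Fin.snoc x s)) (r.integrand (Fin.snoc x t)) t)
    (hconv : ∀ x, Convex ℝ (soloInformedFibre C x)) (hpos : ∀ z ∈ C, 0 < r.integrand z) :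
    of (soloInformedCadRep r C) -
      of (soloInformedCellPosSheet r F C hFs hC hCr hCo hG hFG hCG hdom hNL hconv hpos) ∈
      soloInformedEquidimRelations :=
  soloInformed_of_sub_of_posSheet_mem _ _ _ _ _ _ _ _

/-- **Negative cell sheet** (`f < 0` on `C`). -/
def soloInformedCellNegSheet (r : IntegralRep (n + 1)) (F : (Fin (n + 1) → ℝ) → ℝ)
    (C : Set (Fin (n + 1) → ℝ)) {G : Set (Fin (n + 1) → ℝ)} {τ : Set (Fin n → ℝ)}
    {a b : (Fin n → ℝ) → ℝ} (hFs : IsSemialgebraicFunOn ℚ r.domain F)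
    (hC : IsSemialgebraic ℚ C) (hCr : C ⊆ r.domain) (hCo : IsOpen C) (hG : IsOpen G)
    (hFG : ContDiffOn ℝ ∞ F G) (hCG : C ⊆ G) (hdom : r.domain = KZlog.band τ a b)
    (hNL : ∀ x ∈ τ, ∀ t ∈ Ioo (a x) (b x),
      HasDerivAt (fun s : ℝ => F (Fin.snoc x s)) (r.integrand (Fin.snoc x t)) t)
    (hconv : ∀ x, Convex ℝ (soloInformedFibre C x)) (hneg : ∀ z ∈ C, r.integrand z < 0) :
    IntegralRep (n + 1) :=
  soloInformedNegSheet (soloInformedCadRep r C) F (fun z => fderiv ℝ F z)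
    (by rw [soloInformed_cadRep_domain r hC hCr]; exact hFs.mono hCr hC)
    (soloInformed_nl_sheetData_cadRep r hC hCr hCo hG hFG hCG hdom hNL).1
    (by rw [soloInformed_cadRep_domain r hC hCr]; exact hconv)
    (soloInformed_nl_sheetData_cadRep r hC hCr hCo hG hFG hCG hdom hNL).2
    (fun z hz => by
      rw [soloInformed_cadRep_integrand]
      exact hneg z (by rw [soloInformed_cadRep_domain r hC hCr] at hz; exact hz))

/-- The negative cell sheet has domain `Ψ_F '' C`. -/
theorem soloInformed_cellNegSheet_domain (hFs : IsSemialgebraicFunOn ℚ r.domain F)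
    (hC : IsSemialgebraic ℚ C) (hCr : C ⊆ r.domain) (hCo : IsOpen C) (hG : IsOpen G)
    (hFG : ContDiffOn ℝ ∞ F G) (hCG : C ⊆ G) (hdom : r.domain = KZlog.band τ a b)
    (hNL : ∀ x ∈ τ, ∀ t ∈ Ioo (a x) (b x),
      HasDerivAt (fun s : ℝ => F (Fin.snoc x s)) (r.integrand (Fin.snoc x t)) t)
    (hconv : ∀ x, Convex ℝ (soloInformedFibre C x)) (hneg : ∀ z ∈ C, r.integrand z < 0) :
    (soloInformedCellNegSheet r F C hFs hC hCr hCo hG hFG hCG hdom hNL hconv hneg).domain =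
      soloInformedLastSubst F '' C := by
  show soloInformedLastSubst F '' (soloInformedCadRep r C).domain = soloInformedLastSubst F '' C
  rw [soloInformed_cadRep_domain r hC hCr]

/-- The negative cell sheet has integrand `1`. -/
@[simp] theorem soloInformed_cellNegSheet_integrand (hFs : IsSemialgebraicFunOn ℚ r.domain F)
    (hC : IsSemialgebraic ℚ C) (hCr : C ⊆ r.domain) (hCo : IsOpen C) (hG : IsOpen G)
    (hFG : ContDiffOn ℝ ∞ F G) (hCG : C ⊆ G) (hdom : r.domain = KZlog.band τ a b)
    (hNL : ∀ x ∈ τ, ∀ t ∈ Ioo (a x) (b x),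
      HasDerivAt (fun s : ℝ => F (Fin.snoc x s)) (r.integrand (Fin.snoc x t)) t)
    (hconv : ∀ x, Convex ℝ (soloInformedFibre C x)) (hneg : ∀ z ∈ C, r.integrand z < 0) :
    (soloInformedCellNegSheet r F C hFs hC hCr hCo hG hFG hCG hdom hNL hconv hneg).integrand =
      fun _ => 1 :=
  rfl

/-- **The cell piece plus its negative sheet is a relation.** -/
theorem soloInformed_of_cadRep_add_of_cellNegSheet_mem (hFs : IsSemialgebraicFunOn ℚ r.domain F)
    (hC : IsSemialgebraic ℚ C) (hCr : C ⊆ r.domain) (hCo : IsOpen C) (hG : IsOpen G)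
    (hFG : ContDiffOn ℝ ∞ F G) (hCG : C ⊆ G) (hdom : r.domain = KZlog.band τ a b)
    (hNL : ∀ x ∈ τ, ∀ t ∈ Ioo (a x) (b x),
      HasDerivAt (fun s : ℝ => F (Fin.snoc x s)) (r.integrand (Fin.snoc x t)) t)
    (hconv : ∀ x, Convex ℝ (soloInformedFibre C x)) (hneg : ∀ z ∈ C, r.integrand z < 0) :
    of (soloInformedCadRep r C) +
      of (soloInformedCellNegSheet r F C hFs hC hCr hCo hG hFG hCG hdom hNL hconv hneg) ∈
      soloInformedEquidimRelations :=
  soloInformed_of_add_of_negSheet_mem _ _ _ _ _ _ _ _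

end CellSheet

/-! ### Crossing graphs -/

/-- `x ↦ F (x, u x)` is `ℚ`-semialgebraic on `S` when `u` is and the graph of `u` over `S` lies
in a set on which `F` is semialgebraic (Tarski–Seidenberg). -/
theorem soloInformed_isSemialgebraicFunOn_comp_snoc {S : Set (Fin n → ℝ)} (hS : IsSemialgebraic ℚ S)
    {u : (Fin n → ℝ) → ℝ} (hu : IsSemialgebraicFunOn ℚ S u) {A : Set (Fin (n + 1) → ℝ)}
    {F : (Fin (n + 1) → ℝ) → ℝ} (hF : IsSemialgebraicFunOn ℚ A F)
    (hmaps : ∀ x ∈ S, (Fin.snoc x (u x) : Fin (n + 1) → ℝ) ∈ A) :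
    IsSemialgebraicFunOn ℚ S (fun x => F (Fin.snoc x (u x))) := by
  have hmap : IsSemialgebraicMapOn ℚ S (fun x : Fin n → ℝ => (Fin.snoc x (u x) : Fin (n + 1) → ℝ)) := by
    refine IsSemialgebraicMapOn.of_forall hS fun j => ?_
    refine Fin.lastCases ?_ (fun i => ?_) j
    · simpa only [Fin.snoc_last] using hu
    · simpa [Fin.snoc_castSucc] using
        isSemialgebraicFunOn_aeval (R := ℝ) hS (X i : MvPolynomial (Fin n) ℚ)
  exact IsSemialgebraicFunOn.comp_isSemialgebraicMapOn_holds hF hmap fun x hx => hmaps x hx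

/-- **Open cells avoid adapted crossing graphs.**  If `𝒯'` is adapted to the graph of a
semialgebraic `v` over `S` (a `ℚ`-semialgebraic null set:
`isSemialgebraicFunOn_iff_isSemialgebraic_graphOver`, `KZ.volume_graph_eq_zero`) then a point `w`
of an open cell with `init w ∈ S` has `w last ≠ v (init w)`. -/
theorem soloInformed_ne_of_openCell {𝒯' 𝒞' : Finset (Set (Fin (n + 1) → ℝ))}
    (h𝒯' : IsCylindricalDecomposition ℚ (n + 1) 𝒯') {S : Set (Fin n → ℝ)} {v : (Fin n → ℝ) → ℝ}
    (hv : IsSemialgebraicFunOn ℚ S v) (h𝒞' : 𝒞' ⊆ 𝒯')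
    (hU : ⋃₀ (𝒞' : Set (Set (Fin (n + 1) → ℝ))) = graphOver S v) {D : Set (Fin (n + 1) → ℝ)}
    (hD : D ∈ 𝒯') (hDo : IsOpen D) {w : Fin (n + 1) → ℝ} (hw : w ∈ D) (hxS : Fin.init w ∈ S) :
    w (Fin.last n) ≠ v (Fin.init w) := by
  intro heq
  rcases soloInformed_cell_subset_or_disjoint h𝒯'.isPartition h𝒞' hU hD with h | h
  · exact soloInformed_not_subset_of_isOpen_of_volume_eq_zero h𝒯' hD hDo
      (N := graphOver S v) (volume_graph_eq_zero hv) h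
  · exact disjoint_left.1 h hw (mem_graphOver_iff.2 ⟨hxS, heq⟩)

/-! ### Signed multiplicity of one band sheet (LEMMA C) -/

/-- The fibre of a band over a point of its base cell is the open interval between the two
sections. -/
theorem soloInformed_fibre_bandOver_of_mem {S : Set (Fin n → ℝ)} {l : ℕ}
    {ξ : Fin l → (Fin n → ℝ) → ℝ} {j : Fin (l + 1)} {x : Fin n → ℝ} (hx : x ∈ S) (h0 : j ≠ 0)
    (hl : j ≠ Fin.last l) :
    soloInformedFibre (bandOver S ξ j) x = Ioo (ξ (j.pred h0) x) (ξ (j.castPred hl) x) := by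
  ext t
  rw [soloInformed_mem_fibre, snoc_mem_bandOver_iff_of_ne h0 hl]
  exact ⟨fun h => h.2, fun h => ⟨hx, h⟩⟩

open Classical in
/-- The indicator of the substitution image of a band is the hit indicator of the fibre map. -/
theorem soloInformed_indicator_image_band_eq_hit {F : (Fin (n + 1) → ℝ) → ℝ} {S : Set (Fin n → ℝ)}
    {l : ℕ} {ξ : Fin l → (Fin n → ℝ) → ℝ} {j : Fin (l + 1)} {w : Fin (n + 1) → ℝ}
    (hx : Fin.init w ∈ S) (h0 : j ≠ 0) (hl : j ≠ Fin.last l) :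
    (if w ∈ soloInformedLastSubst F '' bandOver S ξ j then (1 : ℤ) else 0) =
      soloInformedHit (fun s : ℝ => F (Fin.snoc (Fin.init w) s)) (ξ (j.pred h0) (Fin.init w))
        (ξ (j.castPred hl) (Fin.init w)) (w (Fin.last n)) := by
  rw [soloInformed_mem_image_lastSubst_iff, soloInformed_fibre_bandOver_of_mem hx h0 hl]
  by_cases h : w (Fin.last n) ∈ (fun s : ℝ => F (Fin.snoc (Fin.init w) s)) ''
      Ioo (ξ (j.pred h0) (Fin.init w)) (ξ (j.castPred hl) (Fin.init w))
  · rw [if_pos h, soloInformed_hit_of_mem h]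
  · rw [if_neg h, soloInformed_hit_of_not_mem h]

open Classical in
/-- **LEMMA C for one band sheet**: off the two crossing values, `ε·𝟙[w ∈ Ψ_F(C_j)] =
sInd (F(x, lo_j)) (F(x, hi_j)) (w last)`. -/
theorem soloInformed_sign_mul_indicator_image_band {F : (Fin (n + 1) → ℝ) → ℝ}
    {S : Set (Fin n → ℝ)} {l : ℕ} {ξ : Fin l → (Fin n → ℝ) → ℝ} {j : Fin (l + 1)}
    {w : Fin (n + 1) → ℝ} (hx : Fin.init w ∈ S) (h0 : j ≠ 0) (hl : j ≠ Fin.last l)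
    (hlt : ξ (j.pred h0) (Fin.init w) < ξ (j.castPred hl) (Fin.init w))
    (hc : ContinuousOn (fun s : ℝ => F (Fin.snoc (Fin.init w) s))
      (Icc (ξ (j.pred h0) (Fin.init w)) (ξ (j.castPred hl) (Fin.init w)))) {ε : ℤ}
    (hε : SoloInformedPieceType (fun s : ℝ => F (Fin.snoc (Fin.init w) s))
      (ξ (j.pred h0) (Fin.init w)) (ξ (j.castPred hl) (Fin.init w)) ε)
    (hy₁ : w (Fin.last n) ≠ F (Fin.snoc (Fin.init w) (ξ (j.pred h0) (Fin.init w))))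
    (hy₂ : w (Fin.last n) ≠ F (Fin.snoc (Fin.init w) (ξ (j.castPred hl) (Fin.init w)))) :
    ε * (if w ∈ soloInformedLastSubst F '' bandOver S ξ j then 1 else 0) =
      soloInformedSInd (F (Fin.snoc (Fin.init w) (ξ (j.pred h0) (Fin.init w))))
        (F (Fin.snoc (Fin.init w) (ξ (j.castPred hl) (Fin.init w)))) (w (Fin.last n)) := by
  rw [soloInformed_indicator_image_band_eq_hit hx h0 hl]
  exact soloInformed_piece_hit_eq_sInd hlt hc hε hy₁ hy₂

/-- The piece type of a fibre map on a sub-interval of `(a x, b x)` from the Newton–Leibniz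
derivative hypothesis and a sign of the integrand. -/
theorem soloInformed_pieceType_of_sign {g f : ℝ → ℝ} {a₀ b₀ lo hi : ℝ} {ε : ℤ}
    (hd : ∀ t ∈ Ioo a₀ b₀, HasDerivAt g (f t) t) (hlo : a₀ ≤ lo) (hhi : hi ≤ b₀)
    (hsign : (ε = 1 ∧ ∀ t ∈ Ioo lo hi, 0 < f t) ∨ (ε = -1 ∧ ∀ t ∈ Ioo lo hi, f t < 0) ∨
      (ε = 0 ∧ ∀ t ∈ Ioo lo hi, f t = 0)) : SoloInformedPieceType g lo hi ε :=
  soloInformed_pieceType_of_hasDerivAt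
    (fun t ht => hd t ⟨lt_of_le_of_lt hlo ht.1, lt_of_lt_of_le ht.2 hhi⟩) hsign

/-! ### The sum over the bands of `B` over one base point (fibrewise telescope) -/

section Telescope

variable {𝒯 : Finset (Set (Fin (n + 1) → ℝ))} {𝒮 : Finset (Set (Fin n → ℝ))}
  {lS : Set (Fin n → ℝ) → ℕ} {ξ : (S : Set (Fin n → ℝ)) → Fin (lS S) → (Fin n → ℝ) → ℝ}
  {τ : Set (Fin n → ℝ)} {a b : (Fin n → ℝ) → ℝ}
  {𝒞 : Finset (Set (Fin (n + 1) → ℝ))} {S : Set (Fin n → ℝ)}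

/-- `sInd` of the values at the ends of an inner band is the difference of the step indicators at
`bandLower`/`bandUpper`. -/
theorem soloInformed_sInd_eq_stepInd_band {F : (Fin (n + 1) → ℝ) → ℝ} {l : ℕ}
    (ξ : Fin l → (Fin n → ℝ) → ℝ) {j : Fin (l + 1)} (h0 : j ≠ 0) (hl : j ≠ Fin.last l)
    (x : Fin n → ℝ) (y : ℝ) :
    soloInformedSInd (F (Fin.snoc x (ξ (j.pred h0) x))) (F (Fin.snoc x (ξ (j.castPred hl) x))) y =
      soloInformedStepInd (F (Fin.snoc x (bandLower ξ j x).toReal)) y -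
        soloInformedStepInd (F (Fin.snoc x (bandUpper ξ j x).toReal)) y := by
  rw [bandLower_of_ne_zero ξ j h0 x, bandUpper_of_ne_last ξ j hl x, EReal.toReal_coe,
    EReal.toReal_coe]
  rfl

open Classical in
/-- **The band sheets over one base point have total signed multiplicity
`sInd (F(x, a x)) (F(x, b x)) y`.**  Here `S ∈ 𝒮` is the base cell of `x = init w`, `S ⊆ τ`,
`𝒯` is adapted to `B = band τ a b`, `ε j` is the piece type of the fibre map on band `j`, and
`y = w last` avoids the crossing values `F(x, ξ_i x)` of the sections inside `[a x, b x]`. -/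
theorem soloInformed_sum_sign_mul_indicator_eq_sInd
    (h𝒯 : Setoid.IsPartition (𝒯 : Set (Set (Fin (n + 1) → ℝ))))
    (h𝒮 : Setoid.IsPartition (𝒮 : Set (Set (Fin n → ℝ))))
    (hmono : ∀ S ∈ 𝒮, ∀ x ∈ S, StrictMono fun j => ξ S j x)
    (hmem : ∀ T, T ∈ 𝒯 ↔ ∃ S ∈ 𝒮, (∃ j, T = graphOver S (ξ S j)) ∨ ∃ j, T = bandOver S (ξ S) j)
    (h𝒞 : 𝒞 ⊆ 𝒯) (hU : ⋃₀ (𝒞 : Set (Set (Fin (n + 1) → ℝ))) = KZlog.band τ a b) (hS : S ∈ 𝒮)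
    (hSτ : S ⊆ τ) {F : (Fin (n + 1) → ℝ) → ℝ} {w : Fin (n + 1) → ℝ} (hx : Fin.init w ∈ S)
    (hab : a (Fin.init w) ≤ b (Fin.init w))
    (hcont : ContinuousOn (fun s : ℝ => F (Fin.snoc (Fin.init w) s))
      (Icc (a (Fin.init w)) (b (Fin.init w))))
    (ε : Fin (lS S + 1) → ℤ)
    (hε : ∀ (j : Fin (lS S + 1)) (h0 : j ≠ 0) (hl : j ≠ Fin.last (lS S)),
      bandOver S (ξ S) j ⊆ KZlog.band τ a b →
        SoloInformedPieceType (fun s : ℝ => F (Fin.snoc (Fin.init w) s))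
          (ξ S (j.pred h0) (Fin.init w)) (ξ S (j.castPred hl) (Fin.init w)) (ε j))
    (hy : ∀ i, a (Fin.init w) ≤ ξ S i (Fin.init w) → ξ S i (Fin.init w) ≤ b (Fin.init w) →
      w (Fin.last n) ≠ F (Fin.snoc (Fin.init w) (ξ S i (Fin.init w)))) :
    ∑ j ∈ Finset.univ.filter (fun j : Fin (lS S + 1) => bandOver S (ξ S) j ⊆ KZlog.band τ a b),
      ε j * (if w ∈ soloInformedLastSubst F '' bandOver S (ξ S) j then 1 else 0) =
      soloInformedSInd (F (Fin.snoc (Fin.init w) (a (Fin.init w))))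
        (F (Fin.snoc (Fin.init w) (b (Fin.init w)))) (w (Fin.last n)) := by
  have hm := hmono S hS _ hx
  have hterm : ∀ j ∈ Finset.univ.filter
      (fun j : Fin (lS S + 1) => bandOver S (ξ S) j ⊆ KZlog.band τ a b),
      ε j * (if w ∈ soloInformedLastSubst F '' bandOver S (ξ S) j then 1 else 0) =
        soloInformedStepInd (F (Fin.snoc (Fin.init w) (bandLower (ξ S) j (Fin.init w)).toReal))
            (w (Fin.last n)) -
          soloInformedStepInd (F (Fin.snoc (Fin.init w) (bandUpper (ξ S) j (Fin.init w)).toReal))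
            (w (Fin.last n)) := by
    intro j hj
    rw [Finset.mem_filter] at hj
    obtain ⟨h0, hl, hlo, hhi⟩ := soloInformed_bounds_of_band_subset hmono hS hx hj.2
    have hlt : ξ S (j.pred h0) (Fin.init w) < ξ S (j.castPred hl) (Fin.init w) := by
      apply hm
      rw [Fin.lt_def, Fin.val_pred, Fin.coe_castPred]
      have := Fin.val_ne_of_ne h0
      rw [Fin.val_zero] at this
      omega
    rw [← soloInformed_sInd_eq_stepInd_band (ξ S) h0 hl]
    exact soloInformed_sign_mul_indicator_image_band hx h0 hl hlt
      (hcont.mono (Icc_subset_Icc hlo hhi)) (hε j h0 hl hj.2)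
      (hy _ hlo (hlt.le.trans hhi)) (hy _ (hlo.trans hlt.le) hhi)
  rw [Finset.sum_congr rfl hterm]
  exact soloInformed_band_telescope h𝒯 h𝒮 hmono hmem h𝒞 hU hS hSτ hx hab
    (fun t => soloInformedStepInd (F (Fin.snoc (Fin.init w) t)) (w (Fin.last n))) _
    (fun j => by rw [Finset.mem_filter]; exact ⟨fun h => h.2, fun h => ⟨Finset.mem_univ _, h⟩⟩)

end Telescope

end Summit.KontsevichZagierPeriods.KontsevichZagierPeriods.Theorems
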